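import Mathlib
import HarnessLib
import HarnessLib.Audit
import Summits.ValiantsHypothesis.ValiantsHypothesis.Theorems.LacunarySymmetroidMatrixDescartesZeroChangeRows

/-!
# ValiantsHypothesis / LacunarySymmetroid — crux `MatrixDescartes` (stmt-ValiantsHypothesis-18050, V1), LINE (A) «product_plus_one»:
# the CONCAVITY BUDGET, abstract half — `posCrit Φ ≤ 2·#(non-good critical points) + #(positive roots) + 1` for ANY real polynomial

The registered floor stub `stub_oneChangeFloorK3 : OneChangeFloorK3` of `Cruxes/MatrixDescartes/Lines/product_plus_one.lean` (rev 40)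
counts `Z₊(eulerNumerator d a 0) = posCrit (∏_j row …)` (✓ `card_posRoots_euler_bottom_eq_posCrit`), and the pen's CONCAVITY CRITERION
(✓ `concavityCriterion`, card `Ideas/arrangement-concavity-dip-count.md`, NOTE §56.7) makes every off-root positive critical point with
middle-letter sum `M > 0` a GOOD point: `Φ′(t) = 0` and `Φ(t)·Φ″(t) < 0`, a strict local maximum of `|Φ|`.  The card's successor cut C⁺
(«floor ⟺ linear budget on the dips») was bookkept on paper for GENERIC companies; this file and its sequel `…ZeroChangeConcavityBudgetFloor`
put the bookkeeping in the kernel for ALL polynomials / companies (degenerate critical points included):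

* §1 `exists_nhd_lt_of_deriv2` — `Φ′(x) = 0`, `c·Φ″(x) < 0` ⇒ `c·Φ(w) < c·Φ(x)` for all `w ≠ x` near `x` (slope sign of `Φ′` + mean value);
* §2 `exists_crit_not_good_between` — between two GOOD points with no root of `Φ` in between lies a critical point that is NOT good
  (the interior minimum of `|Φ|` on the segment);
* §3 `card_le_card_add_one_of_separated` — a finite set of reals each two of whose points are separated by a point of `B` has `≤ |B| + 1` points;
* §4 ★ `posCrit_le_two_mul_card_notGood_add` — for ANY `Φ : ℝ[X]`:
  `posCrit Φ ≤ 2·#{t > 0 : Φ′(t) = 0, ¬(Φ(t)Φ″(t) < 0)} + #{t > 0 : Φ(t) = 0} + 1`.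

The sequel specialises to row products (non-good off the roots ⇒ `M ≤ 0` = BAD), bounds the roots of one-change companies by `m`, and
derives the body of `OneChangeFloorK3` from a linear budget on the bad points (`oneChangeFloorK3_of_badBudget`).

HONEST FRAMING: helper / joint, def-free, no named facts, no sorry, standard axioms; closes NO stub by name; `OneChangeFloorK3`,
`MatrixDescartes` (stmt-ValiantsHypothesis-18050) OPEN; `VP ≠ VNP` is NOT proved and nothing here bears on it.

[folklore] Second-derivative test / Rolle-type interval bookkeeping; elementary real analysis, no citation needed.
-/

set_option linter.dupNamespace false

namespace Summit.ValiantsHypothesis.ValiantsHypothesis.Theorems.LacunarySymmetroidMatrixDescartes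

namespace ZeroChange

open Polynomial Finset Filter Topology

/-! ## §1 Local analysis: a critical point `x` with `c·Φ″(x) < 0` is a strict local maximum of `w ↦ c·Φ(w)` -/

/-- A function vanishing at `x` with negative derivative there is negative just right of `x`. -/
theorem neg_right_of_hasDerivAt_neg {f : ℝ → ℝ} {x f' : ℝ} (hf : HasDerivAt f f' x) (hx : f x = 0)
    (hf' : f' < 0) : ∃ δ > 0, ∀ y, x < y → y < x + δ → f y < 0 := by
  have ht := (hasDerivAt_iff_tendsto_slope.1 hf).eventually (gt_mem_nhds hf')
  rw [eventually_nhdsWithin_iff, Metric.eventually_nhds_iff] at ht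
  obtain ⟨δ, hδ, hδ'⟩ := ht
  refine ⟨δ, hδ, fun y hxy hyδ => ?_⟩
  have hy : slope f x y < 0 :=
    hδ' (by rw [Real.dist_eq, abs_of_pos (by linarith)]; linarith) (ne_of_gt hxy)
  rw [slope_def_field, hx, sub_zero] at hy
  exact (div_neg_iff.1 hy).elim (fun h => absurd h.2 (not_lt.2 (by linarith))) (fun h => h.1)

/-- A function vanishing at `x` with negative derivative there is positive just left of `x`. -/
theorem pos_left_of_hasDerivAt_neg {f : ℝ → ℝ} {x f' : ℝ} (hf : HasDerivAt f f' x) (hx : f x = 0)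
    (hf' : f' < 0) : ∃ δ > 0, ∀ y, x - δ < y → y < x → 0 < f y := by
  have ht := (hasDerivAt_iff_tendsto_slope.1 hf).eventually (gt_mem_nhds hf')
  rw [eventually_nhdsWithin_iff, Metric.eventually_nhds_iff] at ht
  obtain ⟨δ, hδ, hδ'⟩ := ht
  refine ⟨δ, hδ, fun y hxy hyx => ?_⟩
  have hy : slope f x y < 0 :=
    hδ' (by rw [Real.dist_eq, abs_of_neg (by linarith)]; linarith) (ne_of_lt hyx)
  rw [slope_def_field, hx, sub_zero] at hy
  exact (div_neg_iff.1 hy).elim (fun h => h.1) (fun h => absurd h.2 (not_lt.2 (by linarith)))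

/-- **Strict local maximum from the second derivative**: if `Φ′(x) = 0` and `c·Φ″(x) < 0` then `c·Φ(w) < c·Φ(x)` for all
`w ≠ x` in a neighbourhood of `x` (mean value theorem on either side). -/
theorem exists_nhd_lt_of_deriv2 (Φ : ℝ[X]) (c x : ℝ) (h1 : (derivative Φ).eval x = 0)
    (h2 : c * (derivative (derivative Φ)).eval x < 0) :
    ∃ δ > 0, ∀ w, x - δ < w → w < x + δ → w ≠ x → c * Φ.eval w < c * Φ.eval x := by
  set g : ℝ → ℝ := fun w => c * (derivative Φ).eval w with hg
  set ψ : ℝ → ℝ := fun w => c * Φ.eval w with hψ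
  have hgd : HasDerivAt g (c * (derivative (derivative Φ)).eval x) x :=
    ((derivative Φ).hasDerivAt x).const_mul c
  have hgx : g x = 0 := by simp [hg, h1]
  have hψd : ∀ w, HasDerivAt ψ (g w) w := fun w => (Φ.hasDerivAt w).const_mul c
  have hψc : Continuous ψ := continuous_const.mul Φ.continuous_aeval
  obtain ⟨δ₁, hδ₁, hright⟩ := neg_right_of_hasDerivAt_neg hgd hgx h2
  obtain ⟨δ₂, hδ₂, hleft⟩ := pos_left_of_hasDerivAt_neg hgd hgx h2
  refine ⟨min δ₁ δ₂, lt_min hδ₁ hδ₂, fun w hw1 hw2 hwx => ?_⟩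
  rcases lt_or_gt_of_ne hwx with hlt | hgt
  · -- `w < x`: `ψ x − ψ w = g ξ · (x − w)` with `g ξ > 0`
    obtain ⟨ξ, hξ, hξeq⟩ := exists_hasDerivAt_eq_slope ψ g hlt hψc.continuousOn (fun y _ => hψd y)
    have hξpos : 0 < g ξ := hleft ξ (by linarith [min_le_right δ₁ δ₂, hξ.1]) hξ.2
    rw [hξeq] at hξpos
    have := (div_pos_iff.1 hξpos).resolve_right (fun h => absurd h.2 (not_lt.2 (by linarith)))
    change c * Φ.eval w < c * Φ.eval x
    linarith [this.1]
  · -- `x < w`: `ψ w − ψ x = g ξ · (w − x)` with `g ξ < 0`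
    obtain ⟨ξ, hξ, hξeq⟩ := exists_hasDerivAt_eq_slope ψ g hgt hψc.continuousOn (fun y _ => hψd y)
    have hξneg : g ξ < 0 := hright ξ hξ.1 (by linarith [min_le_left δ₁ δ₂, hξ.2])
    rw [hξeq] at hξneg
    have := (div_neg_iff.1 hξneg).resolve_left (fun h => absurd h.2 (not_lt.2 (by linarith)))
    change c * Φ.eval w < c * Φ.eval x
    linarith [this.1]

/-! ## §2 Between two GOOD critical points with no root in between lies a critical point that is NOT good -/

/-- **Window lemma.**  Call a point `t` GOOD for `Φ` when `Φ′(t) = 0` and `Φ(t)·Φ″(t) < 0` (a strict local maximum of `|Φ|` off the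
roots).  If `x < y` are good and `Φ` has no root in `(x, y)`, then some critical point `z ∈ (x, y)` of `Φ` is not good
(the minimum of `|Φ|` on `[x, y]` is attained in the interior). -/
theorem exists_crit_not_good_between (Φ : ℝ[X]) {x y : ℝ} (hxy : x < y)
    (hx1 : (derivative Φ).eval x = 0) (hx2 : Φ.eval x * (derivative (derivative Φ)).eval x < 0)
    (hy1 : (derivative Φ).eval y = 0) (hy2 : Φ.eval y * (derivative (derivative Φ)).eval y < 0)
    (hnoroot : ∀ z, x < z → z < y → Φ.eval z ≠ 0) :
    ∃ z, x < z ∧ z < y ∧ (derivative Φ).eval z = 0 ∧ ¬ (Φ.eval z * (derivative (derivative Φ)).eval z < 0) := by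
  have hc0 : Φ.eval x ≠ 0 := fun h => by rw [h, zero_mul] at hx2; exact lt_irrefl 0 hx2
  have hψc : Continuous (fun w => Φ.eval x * Φ.eval w) := continuous_const.mul Φ.continuous_aeval
  have hxx : 0 < Φ.eval x * Φ.eval x := mul_self_pos.2 hc0
  -- `Φ` has the sign of `Φ(x)` on `[x, y]`
  have hsign : ∀ w, x ≤ w → w ≤ y → 0 < Φ.eval x * Φ.eval w := by
    intro w hxw hwy
    by_contra hle
    push Not at hle
    rcases eq_or_lt_of_le hxw with rfl | hxw'
    · exact absurd hxx (not_lt.2 hle)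
    obtain ⟨r, hr, hr0⟩ : ∃ r ∈ Set.Icc x w, Φ.eval x * Φ.eval r = 0 :=
      intermediate_value_Icc' hxw'.le hψc.continuousOn ⟨hle, hxx.le⟩
    have hr0' : Φ.eval r = 0 := (mul_eq_zero.1 hr0).resolve_left hc0
    have hrx : r ≠ x := by rintro rfl; exact hc0 hr0'
    have hry : r ≠ y := by rintro rfl; rw [hr0', zero_mul] at hy2; exact lt_irrefl 0 hy2
    exact hnoroot r (lt_of_le_of_ne hr.1 hrx.symm) (lt_of_le_of_ne (hr.2.trans hwy) hry) hr0'
  -- from `Φ(x)·Φ(t) > 0` and `Φ(t)·Φ″(t) < 0` to `Φ(x)·Φ″(t) < 0`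
  have htransfer : ∀ t, 0 < Φ.eval x * Φ.eval t → Φ.eval t * (derivative (derivative Φ)).eval t < 0 →
      Φ.eval x * (derivative (derivative Φ)).eval t < 0 := by
    intro t h1 h2
    by_contra hge
    push Not at hge
    have hA : 0 ≤ Φ.eval x * (derivative (derivative Φ)).eval t * (Φ.eval t) ^ 2 := mul_nonneg hge (sq_nonneg _)
    have : Φ.eval x * (derivative (derivative Φ)).eval t * (Φ.eval t) ^ 2 =
        (Φ.eval x * Φ.eval t) * (Φ.eval t * (derivative (derivative Φ)).eval t) := by ring
    rw [this] at hA
    exact absurd hA (not_le.2 (mul_neg_of_pos_of_neg h1 h2))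
  -- minimum of `w ↦ Φ(x)·Φ(w)` on `[x, y]`
  obtain ⟨z, hz, hzmin⟩ := isCompact_Icc.exists_isMinOn (Set.nonempty_Icc.2 hxy.le) hψc.continuousOn
  -- a point `t ∈ [x, y)` with `Φ′(t) = 0`, `Φ(x)·Φ″(t) < 0` is not a minimum point: look slightly to its right
  have hnotmin_right : ∀ t, x ≤ t → t < y → (derivative Φ).eval t = 0 →
      Φ.eval x * (derivative (derivative Φ)).eval t < 0 → IsMinOn (fun w => Φ.eval x * Φ.eval w) (Set.Icc x y) t →
      False := by
    intro t hxt hty h1 h2 hmin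
    obtain ⟨δ, hδ, hlt⟩ := exists_nhd_lt_of_deriv2 Φ (Φ.eval x) t h1 h2
    have hw1 : t < min (t + δ / 2) ((t + y) / 2) := lt_min (by linarith) (by linarith)
    have hw2 : min (t + δ / 2) ((t + y) / 2) < t + δ := lt_of_le_of_lt (min_le_left _ _) (by linarith)
    have hw3 : min (t + δ / 2) ((t + y) / 2) ≤ y := (min_le_right _ _).trans (by linarith)
    have h := hlt _ (by linarith) hw2 hw1.ne'
    exact absurd (hmin (show min (t + δ / 2) ((t + y) / 2) ∈ Set.Icc x y from ⟨by linarith, hw3⟩)) (not_le.2 h)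
  -- `z ≠ x`
  have hzx : z ≠ x := by
    rintro rfl
    exact hnotmin_right z le_rfl hxy hx1 hx2 hzmin
  -- `z ≠ y`: look slightly to the left of `y`
  have hzy : z ≠ y := by
    rintro rfl
    obtain ⟨δ, hδ, hlt⟩ := exists_nhd_lt_of_deriv2 Φ (Φ.eval x) z hy1 (htransfer z (hsign z hxy.le le_rfl) hy2)
    have hw1 : max (z - δ / 2) ((x + z) / 2) < z := max_lt (by linarith) (by linarith)
    have hw2 : z - δ < max (z - δ / 2) ((x + z) / 2) := lt_of_lt_of_le (by linarith) (le_max_left _ _)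
    have hw3 : x ≤ max (z - δ / 2) ((x + z) / 2) := le_trans (by linarith) (le_max_right _ _)
    have h := hlt _ hw2 (by linarith) hw1.ne
    exact absurd (hzmin (show max (z - δ / 2) ((x + z) / 2) ∈ Set.Icc x z from ⟨hw3, hw1.le⟩)) (not_le.2 h)
  have hxz : x < z := lt_of_le_of_ne hz.1 hzx.symm
  have hzy' : z < y := lt_of_le_of_ne hz.2 hzy
  -- `z` is an interior minimum: `Φ′(z) = 0`
  have hloc : IsLocalMin (fun w => Φ.eval x * Φ.eval w) z := hzmin.isLocalMin (Icc_mem_nhds hxz hzy')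
  have hderiv : Φ.eval x * (derivative Φ).eval z = 0 :=
    hloc.hasDerivAt_eq_zero ((Φ.hasDerivAt z).const_mul (Φ.eval x))
  have hcrit : (derivative Φ).eval z = 0 := (mul_eq_zero.1 hderiv).resolve_left hc0
  exact ⟨z, hxz, hzy', hcrit, fun hgood =>
    hnotmin_right z hz.1 hzy' hcrit (htransfer z (hsign z hz.1 hz.2) hgood) hzmin⟩

/-! ## §3 Counting: a finite set separated by another is at most one larger -/

/-- **Separation count.**  If between any two points of `A` lies a point of `B`, then `|A| ≤ |B| + 1`. -/
theorem card_le_card_add_one_of_separated (A B : Finset ℝ)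
    (h : ∀ x ∈ A, ∀ y ∈ A, x < y → ∃ z ∈ B, x < z ∧ z < y) : A.card ≤ B.card + 1 := by
  classical
  induction A using Finset.induction_on_max generalizing B with
  | empty => simp
  | insert a s has ih =>
    have hnot : a ∉ s := fun ha => lt_irrefl a (has a ha)
    rw [card_insert_of_notMem hnot]
    rcases s.eq_empty_or_nonempty with hs | hs
    · simp [hs]
    · have ha's : s.max' hs ∈ s := max'_mem s hs
      have ha'a : s.max' hs < a := has _ ha's
      obtain ⟨z, hzB, hz1, hz2⟩ := h (s.max' hs) (mem_insert_of_mem ha's) a (mem_insert_self a s) ha'a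
      have ih' := ih (B.filter (· < s.max' hs)) (by
        intro x hx y hy hxy
        obtain ⟨w, hwB, hw1, hw2⟩ := h x (mem_insert_of_mem hx) y (mem_insert_of_mem hy) hxy
        exact ⟨w, mem_filter.2 ⟨hwB, lt_of_lt_of_le hw2 (le_max' s y hy)⟩, hw1, hw2⟩)
      have hsub : B.filter (· < s.max' hs) ⊆ B.erase z := by
        intro w hw
        rw [mem_filter] at hw
        exact mem_erase.2 ⟨(hw.2.trans hz1).ne, hw.1⟩
      have hle := card_le_card hsub
      rw [card_erase_of_mem hzB] at hle
      have hB : 0 < B.card := card_pos.2 ⟨z, hzB⟩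
      omega

/-! ## §4 The abstract budget: `posCrit Φ ≤ 2·#(non-good positive critical points) + #(positive roots) + 1` -/

/-- **CONCAVITY BUDGET, abstract form** (any real polynomial `Φ`).  With GOOD = «`Φ′(t) = 0` and `Φ(t)·Φ″(t) < 0`»: the number of
distinct positive critical points of `Φ` is at most twice the number of NON-good positive critical points, plus the number of
distinct positive roots of `Φ`, plus one (no two good points are adjacent in `(0,∞) ∖ {roots, non-good critical points}`). -/
theorem posCrit_le_two_mul_card_notGood_add (Φ : ℝ[X]) :
    posCrit Φ ≤ 2 * (((derivative Φ).roots.toFinset.filter (fun t => 0 < t)).filter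
        (fun t => ¬ (Φ.eval t * (derivative (derivative Φ)).eval t < 0))).card
      + (Φ.roots.toFinset.filter (fun t => 0 < t)).card + 1 := by
  classical
  set S := (derivative Φ).roots.toFinset.filter (fun t => 0 < t) with hS
  set G := S.filter (fun t => Φ.eval t * (derivative (derivative Φ)).eval t < 0) with hG
  set N := S.filter (fun t => ¬ (Φ.eval t * (derivative (derivative Φ)).eval t < 0)) with hN
  set R := Φ.roots.toFinset.filter (fun t => 0 < t) with hR
  have hpc : posCrit Φ = S.card := rfl
  have hSGN : G.card + N.card = S.card := card_filter_add_card_filter_not _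
  by_cases hΦ' : derivative Φ = 0
  · have hS0 : S = ∅ := by simp [hS, hΦ']
    rw [hpc, hS0, card_empty]
    exact Nat.zero_le _
  have hΦ : Φ ≠ 0 := fun h => hΦ' (by rw [h, derivative_zero])
  have hmemS : ∀ t, t ∈ S ↔ 0 < t ∧ (derivative Φ).eval t = 0 := by
    intro t; rw [hS, mem_filter, Multiset.mem_toFinset, mem_roots hΦ', IsRoot.def, and_comm]
  have hmemR : ∀ t, t ∈ R ↔ 0 < t ∧ Φ.eval t = 0 := by
    intro t; rw [hR, mem_filter, Multiset.mem_toFinset, mem_roots hΦ, IsRoot.def, and_comm]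
  have hsep : ∀ x ∈ G, ∀ y ∈ G, x < y → ∃ z ∈ N ∪ R, x < z ∧ z < y := by
    intro x hx y hy hxy
    rw [hG, mem_filter] at hx hy
    obtain ⟨hx0, hx1⟩ := (hmemS x).1 hx.1
    obtain ⟨-, hy1⟩ := (hmemS y).1 hy.1
    by_cases hroot : ∃ z, x < z ∧ z < y ∧ Φ.eval z = 0
    · obtain ⟨z, hz1, hz2, hz3⟩ := hroot
      exact ⟨z, mem_union_right _ ((hmemR z).2 ⟨hx0.trans hz1, hz3⟩), hz1, hz2⟩
    · push Not at hroot
      obtain ⟨z, hz1, hz2, hz3, hz4⟩ :=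
        exists_crit_not_good_between Φ hxy hx1 hx.2 hy1 hy.2 (fun z h1 h2 => hroot z h1 h2)
      refine ⟨z, mem_union_left _ ?_, hz1, hz2⟩
      rw [hN, mem_filter]
      exact ⟨(hmemS z).2 ⟨hx0.trans hz1, hz3⟩, hz4⟩
  have hGle := card_le_card_add_one_of_separated G (N ∪ R) hsep
  have hNR : (N ∪ R).card ≤ N.card + R.card := card_union_le _ _
  omega

end ZeroChange

end Summit.ValiantsHypothesis.ValiantsHypothesis.Theorems.LacunarySymmetroidMatrixDescartes
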